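import Summits.Parity.GeneralizedHardyLittlewood.Theorems.LiouvilleShiftedTablesSieveToMAvgCoreSplit
import Literature.NumberTheory.Sieve.HeathBrownIdentity

/-!
# Sieve glue for `SieveToMAvg`, part 10b: the core sums — Heath-Brown's identity on a dyadic range

Support file for item stmt-Parity-14274 (route `LiouvilleShiftedTables`).  On `(x, 2x]`,
Heath-Brown's identity with `K = 3`, `z = (2x)^{1/3}` (`Literature.NumberTheory.Sieve.heathBrown_identity`)
writes `Λ` as `∑_{j=1}^{3} (−1)^{j+1} C(3,j) hbPiece_j`, so
`TT_x(Λ) ≤ ∑_j C(3,j) TT_x(hbPiece_j)` (`TT_vonMangoldt_le`); with parts 2 and 9d this gives the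
dyadic bound `TT_dyadic_le` in terms of the uniform majorants `BII`, `BI2` and the sliver sum `SLIV`.
-/

namespace Summit.Parity.GeneralizedHardyLittlewood.Theorems.SieveToMAvg

open Finset Real
open scoped ArithmeticFunction.zeta ArithmeticFunction.sigma ArithmeticFunction.vonMangoldt
open Literature.NumberTheory.Sieve (moebiusTrunc heathBrown_identity)
open Literature.NumberTheory.Sieve.BFI

/-- The Möbius truncation at scale `x`: `U = ⌊(2x)^{1/3}⌋`. [folklore] -/
noncomputable def Ucut (x : ℝ) : ℕ := ⌊(2 * x) ^ ((1 : ℝ) / 3)⌋₊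

/-- `U ≤ (2x)^{b'}` for `b' ≥ 1/3`, `2x ≥ 1`. [folklore] -/
theorem Ucut_le {x b' : ℝ} (hx : 1 ≤ 2 * x) (hb' : 1 / 3 ≤ b') : (Ucut x : ℝ) ≤ (2 * x) ^ b' := by
  unfold Ucut
  exact (Nat.floor_le (Real.rpow_nonneg (by linarith) _)).trans (Real.rpow_le_rpow_of_exponent_le hx hb')

/-- **Heath-Brown on a dyadic range**: for `x ≥ 0`,
`TT_x(Λ) ≤ ∑_{j=1}^{3} C(3,j) TT_x(hbPiece ⌊(2x)^{1/3}⌋ j)`. [folklore] -/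
theorem TT_vonMangoldt_le (w : ℕ → ℝ) (h Q : ℕ) {x : ℝ} (hx : 0 ≤ x) :
    TT w h Q x (fun n => (Λ n : ℝ)) ≤
      ∑ j ∈ Icc 1 3, (Nat.choose 3 j : ℝ) * TT w h Q x (fun n => hbPiece (Ucut x) j n) := by
  set z : ℝ := (2 * x) ^ ((1 : ℝ) / 3) with hz
  have hz0 : 0 ≤ z := Real.rpow_nonneg (by linarith) _
  have hz3 : z ^ 3 = 2 * x := by
    rw [hz, ← Real.rpow_natCast, ← Real.rpow_mul (by linarith)]; norm_num
  have hcongr : ∀ n ∈ Ioc ⌊x⌋₊ ⌊2 * x⌋₊, (Λ n : ℝ) =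
      ∑ j ∈ Icc 1 3, ((-1 : ℝ) ^ (j + 1) * (Nat.choose 3 j : ℝ)) * hbPiece (Ucut x) j n := by
    intro n hn
    have hn2 : (n : ℝ) ≤ z ^ 3 := by
      rw [hz3]; exact le_trans (by exact_mod_cast (Finset.mem_Ioc.1 hn).2) (Nat.floor_le (by linarith))
    rw [heathBrown_identity (K := 3) (by norm_num) hz0 hn2]
    rfl
  rw [TT_congr w h Q x hcongr]
  refine (TT_sum_le w h Q x (Icc 1 3) _ _).trans (le_of_eq ?_)
  refine Finset.sum_congr rfl fun j _ => ?_
  rw [abs_mul, abs_pow, abs_neg, abs_one, one_pow, one_mul, Nat.abs_cast]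

section Dyadic

variable {x X Δ δ C ρ' A C₂ Cτ a' b' : ℝ} {h Q Kf K e : ℕ}

/-- **The dyadic bound**: at a scale `x` where `ScaleOK j` holds for `j = 1, 2, 3` (with `U = ⌊(2x)^{1/3}⌋`),
`TT_x(Λ) ≤ ∑_{j=1}^{3} C(3,j) log(⌊2x⌋+1) (K^{2j}(BII_j + BI2_j) + SLIV_j)`. [folklore] -/
theorem TT_dyadic_le (hypII : HypII X (-(h : ℤ)) δ C) (hypI2 : HypI2 X (-(h : ℤ)) h ρ' A C₂)
    (ok : ∀ j ∈ Icc 1 3, ScaleOK j x X Δ δ ρ' a' b' (Ucut x) Q) (hKf : 2 * x < (1 + Δ) ^ Kf) (hCτ : 0 ≤ Cτ)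
    (hD : ∀ j ∈ Icc 1 3, (∀ Y : ℝ, 1 ≤ Y → Dtau (4 * j) Y ≤ Cτ * Y * (1 + Real.log Y) ^ e) ∧
      (∀ Y : ℝ, 1 ≤ Y → Dtau (2 * j) Y ≤ Cτ * Y * (1 + Real.log Y) ^ e))
    (hK : 2 * x < 2 ^ K) :
    TT (lamW h) h Q x (fun n => (Λ n : ℝ)) ≤
      ∑ j ∈ Icc 1 3, (Nat.choose 3 j : ℝ) * (Real.log (⌊2 * x⌋₊ + 1 : ℕ) *
        ((K : ℝ) ^ (2 * j) * (BII j x X C Cτ e Kf Q + BI2 j x X Δ A C₂ Cτ b' e Kf Q) + SLIV j h Q x Δ)) := by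
  have ok1 := ok 1 (by simp)
  have hx1 : 1 ≤ x := ok1.hx
  have hX : 1 ≤ X := by linarith [ok1.hxX]
  refine (TT_vonMangoldt_le (lamW h) h Q (by linarith)).trans (Finset.sum_le_sum fun j hj => ?_)
  refine mul_le_mul_of_nonneg_left ?_ (Nat.cast_nonneg _)
  have hj1 : 1 ≤ j := (Finset.mem_Icc.1 hj).1
  have okj := ok j hj
  set B := (K : ℝ) ^ (2 * j) * (BII j x X C Cτ e Kf Q + BI2 j x X Δ A C₂ Cτ b' e Kf Q) + SLIV j h Q x Δ with hB
  have hB0 : 0 ≤ B := by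
    have h1 := BII_nonneg j (C := C) (by linarith : 1 / 2 ≤ x) hX hCτ e Kf Q
    have h2 := BI2_nonneg j (X := X) (A := A) (C₂ := C₂) (b' := b') (by linarith : 1 / 2 ≤ x) okj.hΔ.le hCτ e Kf Q
    have h3 : 0 ≤ SLIV j h Q x Δ := Finset.sum_nonneg fun _ _ => Finset.sum_nonneg fun _ _ => by positivity
    positivity
  have hpieces : ∀ t < ⌊2 * x⌋₊ + 1, TT (lamW h) h Q x (fun n => hbPieceT (Ucut x) j t n) ≤ B :=
    fun t _ => TT_hbPieceT_le hj1 hypII hypI2 okj hKf hCτ (hD j hj).1 (hD j hj).2 hK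
  have := TT_hbPiece_le (lamW h) h Q x (Ucut x) j (Nat.le_succ _) hB0 hpieces
  rw [mul_comm] at this
  exact this

end Dyadic

end Summit.Parity.GeneralizedHardyLittlewood.Theorems.SieveToMAvg
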